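import Summits.HodgeConjecture.HodgeConjecture.Theses.TropicalWeilObstruction
import Summits.HodgeConjecture.HodgeConjecture.Theorems.TropicalWeilObstructionTropicalWeilVanishingClassPositivityCone
import Summits.HodgeConjecture.HodgeConjecture.Theorems.TropicalWeilObstructionTropicalWeilVanishingClassPositivityTransport
import HarnessLib

/-!
# Route `TropicalWeilObstruction` (Kontsevich's tropical test — NEGATION SINK, exploration, no summit claim):
# class positivity is exhausted by the calibration cone AT EVERY WEIL PERIOD (II)

Negation-sink bookkeeping of the cell `pub-hodge-tropical` (seat tropical-2 gen 5). Part II of two: the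
transport of Part I (`…ClassPositivityTransport`) applied to tropical-1's `Q = 1` certificate
`Kappa.boundaryRay_eq_sum_frameSquares` (p337681, κ = 8).

* `boundaryRay_eq_sum_realFrameSquares` — for EVERY `Q ≻ 0` with `QJ = JQ`:
  `24 · (8 · θ₄(Q) + Re w(Q)) = Σ_{j<206} n_j · p_{hL_j} ⊗ p_{hL_j}` with `h = √Q` (symmetric, commuting with
  `J`), the same positive integers `n_j` and saturated integer frames `L_j` as at `Q = 1`, `p_{hL_j}` the Plücker
  vector of the REAL frame `h·L_j`. The class `8 θ₄(Q) + Re w(Q)` is the boundary ray `(q₀,q₁,q₂) = (8,1,0)` of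
  the calibration cone `64(q₁² + q₂²) ≤ q₀²` (p332805) at `Q`, off the theta line (`Ŵ(Re w(Q)) = 8 det(PQPᴴ) ≠ 0`,
  p331596).
* `nonneg_cyc_of_nonneg_realFrameSquares` (necessity, every period) and
  `nonneg_boundaryRay_of_nonneg_realFrameSquares` (sharpness, every Weil period): a linear functional on the
  class space that is `≥ 0` on the square `p_F ⊗ p_F` of the Plücker vector of every real `8 × 4` matrix is `≥ 0`
  on `cyc Z` for every effective tropical `4`-cycle on every `ℝ⁸/Qℤ⁸`, and `≥ 0` on `8 θ₄(Q) + Re w(Q)`. So the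
  closed convex cone generated by real decomposable squares — which contains every effective class — reaches the
  boundary of the calibration cone inside K3's `3`-space at the very periods K1 speaks about: no class-level
  positivity argument proves K1 or narrows the cone there; a proof of K1 must use the balanced TYPE.

HONEST STATUS. Decides nothing about K1 or about the Hodge conjecture. The passage from "≥ 0 on SATURATED INTEGER
frame squares" (hypothesis of `Kappa.nonneg_cyc_of_nonneg_frameSquares`) to "≥ 0 on REAL frame squares" is
density of rational frames plus saturation (Smith normal form); it is not needed here, both statements being
about real frames. No definition, no named fact, no sorry.
References: [Zharkov2020TropicalWeil] I. Zharkov, arXiv:2002.02347, §2 (pp. 2–4); [MikhalkinZharkov2014Eigenwave]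
G. Mikhalkin, I. Zharkov, LN UMI 15 (2014), Prop. 4.3; [BlekhermanSmithVelasco2016] G. Blekherman, G. G. Smith,
M. Velasco, Sums of squares and varieties of minimal degree, JAMS 29 (2016), Thm. 1.1.
-/

set_option linter.dupNamespace false

noncomputable section

open scoped BigOperators MatrixOrder
open Matrix
open Literature.AlgebraicGeometry.Tropical
open Summit.HodgeConjecture.HodgeConjecture.Theorems.TropicalHodgeBound

namespace Summit.HodgeConjecture.HodgeConjecture.Theorems.TropicalWeilVanishing.Kappa

/-! ## §0 Display-only notation (the K3 skeleton's local definitions, verbatim bodies; nothing is defined) -/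

/-- `P = [1 | i·1]`, the `n × 2n` matrix of `dz₁ ∧ … ∧ dz_n`. -/
local notation3 (prettyPrint := false) "𝐏⟦" n "⟧" =>
  (Matrix.of fun (k : Fin n) (a : Fin (2 * n)) =>
    (if (a : ℕ) = (k : ℕ) then (1 : ℂ) else 0) + (if (a : ℕ) = (k : ℕ) + n then Complex.I else 0))

/-- The skeleton's `thetaClass n Q`. -/
local notation3 (prettyPrint := false) "θ⟦" n "⟧" Q:max =>
  (fun S S' : Fin n → Fin (2 * n) => Matrix.det (Matrix.submatrix Q S S'))

/-- The skeleton's `omegaFrame n` (`Ω = Pᴴ`). -/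
local notation3 (prettyPrint := false) "Ω⟦" n "⟧" =>
  (Matrix.of fun (a : Fin (2 * n)) (b : Fin n) =>
    (if (a : ℕ) = (b : ℕ) then (1 : ℂ) else 0) - (if (a : ℕ) = (b : ℕ) + n then Complex.I else 0))

/-- The skeleton's `weilClassC n Q` (`w(Q) = (⋀ⁿQ ⊗ 1)(Ω ⊗ Ω)`). -/
local notation3 (prettyPrint := false) "wC⟦" n "⟧" Q:max =>
  (fun S S' : Fin n → Fin (2 * n) =>
    Matrix.det (Matrix.submatrix (Matrix.map Q ((↑) : ℝ → ℂ) * Ω⟦n⟧) S id) *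
      Matrix.det (Matrix.submatrix (Ω⟦n⟧) S' id))

/-- The skeleton's `weilClassRe n Q` (`w₁ = Re w`). -/
local notation3 (prettyPrint := false) "wRe⟦" n "⟧" Q:max =>
  (fun S S' : Fin n → Fin (2 * n) => Complex.re ((wC⟦n⟧ Q) S S'))

/-- `M_Q := ½ · P Q Pᴴ`, the matrix of `Q|_{V^{1,0}}` in the frame `Ω` (`QΩ = Ω M_Q`). Nothing is defined. -/
local notation3 (prettyPrint := false) "𝐌⟦" n "⟧" Q:max =>
  ((2 : ℂ)⁻¹ • (𝐏⟦n⟧ * Matrix.map Q ((↑) : ℝ → ℂ) * (𝐏⟦n⟧)ᴴ))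

/-- NEW display-only notation: the square `p_F ⊗ p_F` of the Plücker vector `p_F(S) = det F[S,·]` of a REAL
`8 × 4` matrix `F`, as a real table on word pairs. Nothing is defined. -/
local notation3 (prettyPrint := false) "sq⟦" F "⟧" =>
  (fun S S' : Fin 4 → Fin (2 * 4) =>
    Matrix.det (Matrix.submatrix F S id) * Matrix.det (Matrix.submatrix F S' id))

/-! ## §3 The boundary ray at every Weil period is a positive combination of real frame squares -/

/-- **Class positivity is exhausted by the calibration cone at EVERY Weil period.** For every positive
definite `Q` commuting with `J` there are a positive definite `h` commuting with `J` with `h·h = Q`, positive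
integers `n_j` and SATURATED integer `8 × 4` frames `L_j` (`j < 206`, those of
`Kappa.boundaryRay_eq_sum_frameSquares`) with `24 · (8 · θ₄(Q) + Re w(Q)) = Σ_j n_j · p_{hL_j} ⊗ p_{hL_j}`,
`p_{hL_j}` the Plücker vector of the REAL frame `h·L_j` — the boundary ray `(q₀,q₁,q₂) = (8,1,0)` of the
calibration cone `64(q₁² + q₂²) ≤ q₀²` (p332805) at the period `Q` is a positive combination of squares of
REAL decomposable `4`-vectors. (Transport of the `Q = 1` certificate by the congruence `⋀⁴√Q ⊗ ⋀⁴√Q`.)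
[cite: Zharkov2020TropicalWeil, §2] [cite: MikhalkinZharkov2014Eigenwave, Prop. 4.3]
[cite: BlekhermanSmithVelasco2016, Thm. 1.1] -/
theorem boundaryRay_eq_sum_realFrameSquares (Q : Matrix (Fin (2 * 4)) (Fin (2 * 4)) ℝ) (hQ : Q.PosDef)
    (hJ : Q * weilJ 4 = weilJ 4 * Q) :
    ∃ (h : Matrix (Fin (2 * 4)) (Fin (2 * 4)) ℝ) (w : Fin 206 → ℕ)
      (L : Fin 206 → Matrix (Fin (2 * 4)) (Fin 4) ℤ),
      h.PosDef ∧ h * h = Q ∧ h * weilJ 4 = weilJ 4 * h ∧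
      (∀ j, 0 < w j) ∧ (∀ j, ∃ M : Matrix (Fin 4) (Fin (2 * 4)) ℤ, M * L j = 1) ∧
      (24 : ℝ) • ((8 : ℝ) • θ⟦4⟧ Q + wRe⟦4⟧ Q) =
        ∑ j, ((w j : ℕ) : ℝ) • sq⟦h * (L j).map ((↑) : ℤ → ℝ)⟧ := by
  obtain ⟨w, L, hw, hsat, hid⟩ := boundaryRay_eq_sum_frameSquares
  obtain ⟨h, hpos, hhQ, hhJ, hT⟩ := exists_sqrt_commuting_weilJ Q hQ hJ
  refine ⟨h, w, L, hpos, hhQ, hhJ, hw, hsat, ?_⟩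
  -- the `Q = 1` identity, evaluated at a word pair
  have hid1 : ∀ I I' : Fin 4 → Fin (2 * 4),
      24 * (8 * ((1 : Matrix (Fin (2 * 4)) (Fin (2 * 4)) ℝ).submatrix I I').det +
          (wRe⟦4⟧ (1 : Matrix (Fin (2 * 4)) (Fin (2 * 4)) ℝ)) I I') =
        ∑ j, ((w j : ℕ) : ℝ) * (sq⟦(L j).map ((↑) : ℤ → ℝ)⟧ I I') := by
    intro I I'
    have e := congrFun (congrFun hid I) I'
    simp only [Pi.smul_apply, Pi.add_apply, Finset.sum_apply, smul_eq_mul] at e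
    rw [e]
    refine Finset.sum_congr rfl fun j _ => ?_
    rw [pluckerCoord, pluckerCoord, Int.cast_det, Int.cast_det]
    rfl
  funext S S'
  simp only [Pi.smul_apply, Pi.add_apply, Finset.sum_apply, smul_eq_mul]
  -- push both sides forward by `⋀⁴h ⊗ ⋀⁴h`
  have key : ∑ I : Fin 4 → Fin (2 * 4), ∑ I' : Fin 4 → Fin (2 * 4),
      (h.submatrix S I).det * (h.submatrix S' I').det *
        (24 * (8 * ((1 : Matrix (Fin (2 * 4)) (Fin (2 * 4)) ℝ).submatrix I I').det +
          (wRe⟦4⟧ (1 : Matrix (Fin (2 * 4)) (Fin (2 * 4)) ℝ)) I I')) =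
      ∑ I : Fin 4 → Fin (2 * 4), ∑ I' : Fin 4 → Fin (2 * 4),
        (h.submatrix S I).det * (h.submatrix S' I').det *
          ∑ j, ((w j : ℕ) : ℝ) * (sq⟦(L j).map ((↑) : ℤ → ℝ)⟧ I I') := by
    simp_rw [hid1]
  -- left side
  have hLHS : ∑ I : Fin 4 → Fin (2 * 4), ∑ I' : Fin 4 → Fin (2 * 4),
      (h.submatrix S I).det * (h.submatrix S' I').det *
        (24 * (8 * ((1 : Matrix (Fin (2 * 4)) (Fin (2 * 4)) ℝ).submatrix I I').det +
          (wRe⟦4⟧ (1 : Matrix (Fin (2 * 4)) (Fin (2 * 4)) ℝ)) I I')) =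
      576 * (24 * (8 * (Q.submatrix S S').det + (wRe⟦4⟧ Q) S S')) := by
    have hθ := pushforward_thetaClass_one h hT S S'
    have hwr := pushforward_weilClassRe_one h hhJ S S'
    rw [hhQ] at hθ hwr
    have split : ∀ I : Fin 4 → Fin (2 * 4),
        ∑ I' : Fin 4 → Fin (2 * 4), (h.submatrix S I).det * (h.submatrix S' I').det *
            (24 * (8 * ((1 : Matrix (Fin (2 * 4)) (Fin (2 * 4)) ℝ).submatrix I I').det +
              (wRe⟦4⟧ (1 : Matrix (Fin (2 * 4)) (Fin (2 * 4)) ℝ)) I I')) =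
          192 * (∑ I' : Fin 4 → Fin (2 * 4), (h.submatrix S I).det * (h.submatrix S' I').det *
              ((1 : Matrix (Fin (2 * 4)) (Fin (2 * 4)) ℝ).submatrix I I').det) +
            24 * (∑ I' : Fin 4 → Fin (2 * 4), (h.submatrix S I).det * (h.submatrix S' I').det *
              (wRe⟦4⟧ (1 : Matrix (Fin (2 * 4)) (Fin (2 * 4)) ℝ)) I I') := by
      intro I
      rw [Finset.mul_sum, Finset.mul_sum, ← Finset.sum_add_distrib]
      exact Finset.sum_congr rfl fun I' _ => by ring
    calc ∑ I : Fin 4 → Fin (2 * 4), ∑ I' : Fin 4 → Fin (2 * 4),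
          (h.submatrix S I).det * (h.submatrix S' I').det *
            (24 * (8 * ((1 : Matrix (Fin (2 * 4)) (Fin (2 * 4)) ℝ).submatrix I I').det +
              (wRe⟦4⟧ (1 : Matrix (Fin (2 * 4)) (Fin (2 * 4)) ℝ)) I I'))
        = ∑ I : Fin 4 → Fin (2 * 4),
            (192 * (∑ I' : Fin 4 → Fin (2 * 4), (h.submatrix S I).det * (h.submatrix S' I').det *
                ((1 : Matrix (Fin (2 * 4)) (Fin (2 * 4)) ℝ).submatrix I I').det) +
              24 * (∑ I' : Fin 4 → Fin (2 * 4), (h.submatrix S I).det * (h.submatrix S' I').det *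
                (wRe⟦4⟧ (1 : Matrix (Fin (2 * 4)) (Fin (2 * 4)) ℝ)) I I')) :=
          Finset.sum_congr rfl fun I _ => split I
      _ = 192 * (∑ I : Fin 4 → Fin (2 * 4), ∑ I' : Fin 4 → Fin (2 * 4),
              (h.submatrix S I).det * (h.submatrix S' I').det *
                ((1 : Matrix (Fin (2 * 4)) (Fin (2 * 4)) ℝ).submatrix I I').det) +
            24 * (∑ I : Fin 4 → Fin (2 * 4), ∑ I' : Fin 4 → Fin (2 * 4),
              (h.submatrix S I).det * (h.submatrix S' I').det *
                (wRe⟦4⟧ (1 : Matrix (Fin (2 * 4)) (Fin (2 * 4)) ℝ)) I I') := by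
          rw [Finset.sum_add_distrib, Finset.mul_sum, Finset.mul_sum]
      _ = 576 * (24 * (8 * (Q.submatrix S S').det + (wRe⟦4⟧ Q) S S')) := by
          rw [hθ, hwr]; ring
  -- right side
  have hRHS : ∑ I : Fin 4 → Fin (2 * 4), ∑ I' : Fin 4 → Fin (2 * 4),
      (h.submatrix S I).det * (h.submatrix S' I').det *
        ∑ j, ((w j : ℕ) : ℝ) * (sq⟦(L j).map ((↑) : ℤ → ℝ)⟧ I I') =
      576 * ∑ j, ((w j : ℕ) : ℝ) * (sq⟦h * (L j).map ((↑) : ℤ → ℝ)⟧ S S') := by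
    calc ∑ I : Fin 4 → Fin (2 * 4), ∑ I' : Fin 4 → Fin (2 * 4),
          (h.submatrix S I).det * (h.submatrix S' I').det *
            ∑ j, ((w j : ℕ) : ℝ) * (sq⟦(L j).map ((↑) : ℤ → ℝ)⟧ I I')
        = ∑ I : Fin 4 → Fin (2 * 4), ∑ I' : Fin 4 → Fin (2 * 4), ∑ j,
            ((w j : ℕ) : ℝ) * ((h.submatrix S I).det * (h.submatrix S' I').det *
              (sq⟦(L j).map ((↑) : ℤ → ℝ)⟧ I I')) := by
          refine Finset.sum_congr rfl fun I _ => Finset.sum_congr rfl fun I' _ => ?_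
          rw [Finset.mul_sum]
          exact Finset.sum_congr rfl fun j _ => by ring
      _ = ∑ I : Fin 4 → Fin (2 * 4), ∑ j, ∑ I' : Fin 4 → Fin (2 * 4),
            ((w j : ℕ) : ℝ) * ((h.submatrix S I).det * (h.submatrix S' I').det *
              (sq⟦(L j).map ((↑) : ℤ → ℝ)⟧ I I')) :=
          Finset.sum_congr rfl fun I _ => Finset.sum_comm
      _ = ∑ j, ∑ I : Fin 4 → Fin (2 * 4), ∑ I' : Fin 4 → Fin (2 * 4),
            ((w j : ℕ) : ℝ) * ((h.submatrix S I).det * (h.submatrix S' I').det *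
              (sq⟦(L j).map ((↑) : ℤ → ℝ)⟧ I I')) := Finset.sum_comm
      _ = ∑ j, ((w j : ℕ) : ℝ) * ∑ I : Fin 4 → Fin (2 * 4), ∑ I' : Fin 4 → Fin (2 * 4),
            (h.submatrix S I).det * (h.submatrix S' I').det * (sq⟦(L j).map ((↑) : ℤ → ℝ)⟧ I I') := by
          refine Finset.sum_congr rfl fun j _ => ?_
          rw [Finset.mul_sum]
          refine Finset.sum_congr rfl fun I _ => ?_
          rw [Finset.mul_sum]
      _ = ∑ j, ((w j : ℕ) : ℝ) * ((576 : ℝ) * sq⟦h * (L j).map ((↑) : ℤ → ℝ)⟧ S S') := by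
          refine Finset.sum_congr rfl fun j _ => ?_
          rw [pushforward_frameSquare]
      _ = 576 * ∑ j, ((w j : ℕ) : ℝ) * (sq⟦h * (L j).map ((↑) : ℤ → ℝ)⟧ S S') := by
          rw [Finset.mul_sum]
          exact Finset.sum_congr rfl fun j _ => by ring
  have := key
  rw [hLHS, hRHS] at this
  have h576 : (576 : ℝ) ≠ 0 := by norm_num
  exact mul_left_cancel₀ h576 this

/-! ## §4 Dual form: class-positivity functionals at every period -/

/-- **Necessity at every period.** A linear functional on the class space that is non-negative on the square
`p_F ⊗ p_F` of the Plücker vector of every real `8 × 4` matrix is non-negative on the class `cyc Z` of every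
effective tropical `4`-cycle on every `ℝ⁸/Qℤ⁸` (`cyc Z = Σ_σ w_σ a_σ p_σ ⊗ p_σ`, `w_σ a_σ > 0`, integer frames are
real frames). [cite: MikhalkinZharkov2014Eigenwave, Prop. 4.3] -/
theorem nonneg_cyc_of_nonneg_realFrameSquares
    (Φ : ((Fin 4 → Fin (2 * 4)) → (Fin 4 → Fin (2 * 4)) → ℝ) →ₗ[ℝ] ℝ)
    (hΦ : ∀ F : Matrix (Fin (2 * 4)) (Fin 4) ℝ, 0 ≤ Φ (sq⟦F⟧))
    {Q : Matrix (Fin (2 * 4)) (Fin (2 * 4)) ℝ} (Z : TropicalTorusCycle (2 * 4) 4 Q) :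
    0 ≤ Φ (TropicalTorusCycle.cyc Z) := by
  refine nonneg_cyc_of_nonneg_frameSquares Φ (fun L _ => ?_) Z
  have e : (fun S S' : Fin 4 → Fin (2 * 4) => ((pluckerCoord L S : ℤ) : ℝ) * ((pluckerCoord L S' : ℤ) : ℝ)) =
      sq⟦L.map ((↑) : ℤ → ℝ)⟧ := by
    funext S S'
    rw [pluckerCoord, pluckerCoord, Int.cast_det, Int.cast_det]
    rfl
  rw [e]
  exact hΦ _

/-- **Sharpness at every Weil period: no class-positivity constraint separates the boundary ray.** Every
linear functional on the class space that is non-negative on all real frame squares (hence, by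
`nonneg_cyc_of_nonneg_realFrameSquares`, a necessary condition for effectivity at every period) is non-negative
on `8 · θ₄(Q) + Re w(Q)` — a class with `W ≠ 0` on the boundary of the calibration cone — for EVERY positive
definite `Q` commuting with `J`, in particular at the very general periods of K1. So no argument that factors
through the class `cyc Z` and positivity proves K1 or narrows the cone at any Weil period; a proof of K1 must use
the balancing/closing conditions of the TYPE. Decides nothing about K1 or HC. [cite: Zharkov2020TropicalWeil, §2]
[cite: BlekhermanSmithVelasco2016, Thm. 1.1] -/
theorem nonneg_boundaryRay_of_nonneg_realFrameSquares
    (Φ : ((Fin 4 → Fin (2 * 4)) → (Fin 4 → Fin (2 * 4)) → ℝ) →ₗ[ℝ] ℝ)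
    (hΦ : ∀ F : Matrix (Fin (2 * 4)) (Fin 4) ℝ, 0 ≤ Φ (sq⟦F⟧))
    (Q : Matrix (Fin (2 * 4)) (Fin (2 * 4)) ℝ) (hQ : Q.PosDef) (hJ : Q * weilJ 4 = weilJ 4 * Q) :
    0 ≤ Φ ((8 : ℝ) • θ⟦4⟧ Q + wRe⟦4⟧ Q) := by
  obtain ⟨h, w, L, -, -, -, -, -, hid⟩ := boundaryRay_eq_sum_realFrameSquares Q hQ hJ
  have h24 : (24 : ℝ) * Φ ((8 : ℝ) • θ⟦4⟧ Q + wRe⟦4⟧ Q) =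
      Φ (∑ j, ((w j : ℕ) : ℝ) • sq⟦h * (L j).map ((↑) : ℤ → ℝ)⟧) := by
    rw [← hid, map_smul, smul_eq_mul]
  have hnn : 0 ≤ Φ (∑ j, ((w j : ℕ) : ℝ) • sq⟦h * (L j).map ((↑) : ℤ → ℝ)⟧) := by
    rw [map_sum]
    refine Finset.sum_nonneg fun j _ => ?_
    rw [map_smul, smul_eq_mul]
    exact mul_nonneg (Nat.cast_nonneg _) (hΦ _)
  rw [← h24] at hnn
  linarith

end Summit.HodgeConjecture.HodgeConjecture.Theorems.TropicalWeilVanishing.Kappa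

end
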